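import Literature.NumberTheory.EllipticCurves.ZpExtensionRestrictTwoSqrtTwo
import HarnessLib

set_option autoImplicit false

/-!
# Restriction of the cyclotomic `ℤ₂`-extension of `ℚ` to ANY number field `L`:
# `κ ∘ res : Γ_L → ℤ₂` is onto UNLESS `√2 ∈ L` — the degree hypothesis `4 ∤ [L : ℚ]` removed

Topic `Literature/NumberTheory/EllipticCurves` (companion of `ZpExtensionRestrictTwoSqrtTwo.lean`, whose three theorems carry the hypothesis
`4 ∤ [L : ℚ]`). THEOREM-ONLY file (no definition, no named fact, no `sorry`), written by the prover seat `bsd-line-att-p4` g29 (cell `bsd-f1-sign2`;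
supports stmt-BirchSwinnertonDyer-22298 — the carrier `ℚ(W[2], √−1)` of the registered stub PFμ⁺ has degree `12`, so the old criterion does not
reach it).

Washington, *Introduction to Cyclotomic Fields*, §13.1: `ℚ_∞/ℚ` is a `ℤ₂`-extension, so its subfields are the chain `ℚ ⊂ ℚ_1 = ℚ(√2) ⊂ ℚ_2 ⊂ ⋯`;
hence for EVERY number field `L`, `L ∩ ℚ_∞ ≠ ℚ` iff `ℚ_1 ⊆ L` iff `√2 ∈ L`. In the tree's currency (`κ` a cyclotomic `ℤ₂`-extension of `ℚ`,
`κ ∘ res_{ℚ,L} : Γ_L → ℤ₂`):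

* `surjective_comp_absGaloisRestrict_of_exists_not_dvd'` — if some `κ(res σ)` is a `2`-adic UNIT, then `κ ∘ res` is onto. (No degree hypothesis:
  the image `H = κ(res Γ_L)` is COMPACT, hence closed, and contains `ℤ·u`, which is dense in `ℤ₂·u = ℤ₂` — `ℤ` is dense in `ℤ₂`
  (`PadicInt.denseRange_intCast`) and `u` is a unit.)
* **`surjective_comp_absGaloisRestrict_or_exists_sq_eq_two'`** — `κ ∘ res` is onto, OR `L` contains a square root of `2` (if not onto, every
  `κ(res σ) ∈ 2ℤ₂`, so `res Γ_L ≤ Gal(ℚ̄/ℚ_1)` fixes `√2 ∈ ℚ_1`; infinite Galois correspondence as in the degree-restricted file).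
* **`surjective_comp_absGaloisRestrict_of_forall_sq_ne_two'`** — `√2 ∉ L ⟹ κ ∘ res` onto, for EVERY number field `L`.

References: [Washington1997] §13.1; [NeukirchANT1999] Ch. IV §1; tree `ZpExtensionRestrictTwoSqrtTwo` (cell bsd-2adic), `CyclotomicZpExtensionLayerOneSqrtTwoProofs`,
`ImaginaryQuadraticCyclotomicProofs` (`Rat.exists_eq_of_forall_range_absGaloisRestrict_smul`).
-/

noncomputable section

open Field Literature.NumberTheory.GaloisRepresentations

universe v

namespace Literature.NumberTheory.EllipticCurves.ZpExtension

variable (κ : ZpExtension ℚ 2) (L : Type v) [Field L] [NumberField L]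

/-! ### §1 A compact subgroup of `ℤ₂` containing a unit is everything -/

/-- **If some `κ(res σ₀)` is a `2`-adic unit then `κ ∘ res_{ℚ,L}` is onto**, for ANY number field `L`: the image of the compact group `Γ_L` is a
closed subgroup of `ℤ₂` containing `n·u` for all `n ∈ ℤ` (`u = κ(res σ₀)` a unit), hence — `ℤ` being dense in `ℤ₂` and `x ↦ x·u` a homeomorphism —
all of `ℤ₂`. Degree-free form of `surjective_comp_absGaloisRestrict_of_exists_not_dvd`. [cite: Washington1997, §13.1] -/
theorem surjective_comp_absGaloisRestrict_of_exists_not_dvd'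
    (hex : ∃ σ : absoluteGaloisGroup L, ¬ (2 : ℤ_[2]) ∣ (κ (absGaloisRestrict ℚ L σ)).toAdd) :
    Function.Surjective (κ.toContinuousMonoidHom.comp (absGaloisRestrict ℚ L)) := by
  obtain ⟨σ₀, hσ₀⟩ := hex
  haveI : IsGalois L (AlgebraicClosure L) := IsAlgClosure.isGalois L _
  haveI : CompactSpace (absoluteGaloisGroup L) := inferInstanceAs (CompactSpace (AlgebraicClosure L ≃ₐ[L] AlgebraicClosure L))
  set f := κ.toContinuousMonoidHom.comp (absGaloisRestrict ℚ L) with hf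
  set u : ℤ_[2] := (f σ₀).toAdd with hu
  -- `u` is a unit
  have hunit : IsUnit u := by
    rw [PadicInt.isUnit_iff]
    have hle : ‖u‖ ≤ 1 := PadicInt.norm_le_one _
    have hlt : ¬ ‖u‖ < 1 := fun h ↦ hσ₀ (by
      have := (PadicInt.norm_lt_one_iff_dvd u).mp h
      exact_mod_cast this)
    exact le_antisymm hle (not_lt.mp hlt)
  obtain ⟨u₀, hu₀⟩ := hunit
  -- the (additively written) image is compact, hence closed
  set g : absoluteGaloisGroup L → ℤ_[2] := fun σ ↦ (f σ).toAdd with hg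
  have hgc : Continuous g := continuous_toAdd.comp f.continuous
  have hclosed : IsClosed (Set.range g) := (isCompact_range hgc).isClosed
  -- it contains `n·u` for every integer `n`
  have hint : ∀ n : ℤ, ((n : ℤ_[2]) * u) ∈ Set.range g := by
    intro n
    refine ⟨σ₀ ^ n, ?_⟩
    simp only [hg, hu, map_zpow, toAdd_zpow, zsmul_eq_mul]
  -- hence `c·u` for every `c ∈ ℤ₂` (density of `ℤ` in `ℤ₂`)
  have hall : ∀ c : ℤ_[2], c * u ∈ Set.range g := by
    have hpre : IsClosed ((fun c : ℤ_[2] ↦ c * u) ⁻¹' Set.range g) :=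
      hclosed.preimage (continuous_id.mul continuous_const)
    have hsub : Set.range (Int.cast : ℤ → ℤ_[2]) ⊆ (fun c : ℤ_[2] ↦ c * u) ⁻¹' Set.range g := by
      rintro _ ⟨n, rfl⟩
      exact hint n
    have huniv : (fun c : ℤ_[2] ↦ c * u) ⁻¹' Set.range g = Set.univ := by
      apply Set.eq_univ_of_univ_subset
      rw [← (PadicInt.denseRange_intCast (p := 2)).closure_range]
      exact closure_minimal hsub hpre
    intro c
    have : c ∈ (fun c : ℤ_[2] ↦ c * u) ⁻¹' Set.range g := by rw [huniv]; exact Set.mem_univ _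
    exact this
  intro y
  obtain ⟨σ, hσ⟩ := hall (y.toAdd * (↑u₀⁻¹ : ℤ_[2]))
  refine ⟨σ, ?_⟩
  have hy : y.toAdd * (↑u₀⁻¹ : ℤ_[2]) * u = y.toAdd := by rw [mul_assoc, ← hu₀, Units.inv_mul, mul_one]
  rw [hy] at hσ
  exact Multiplicative.toAdd.injective hσ

/-! ### §2 The dichotomy for every number field: onto, or `√2 ∈ L` -/

/-- **`κ ∘ res_{ℚ,L}` is onto, or `√2 ∈ L`, for EVERY number field `L`** (`κ` a cyclotomic `ℤ₂`-extension of `ℚ`). If it is not onto, no `κ(res σ)` is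
a unit (§1), so `res(Γ_L) ≤ κ⁻¹(2ℤ₂) = Gal(ℚ̄/ℚ_1)` fixes `θ ∈ ℚ_1` with `θ² = 2`, whence `θ ∈ e(L)` (infinite Galois correspondence). Degree-free form of
`surjective_comp_absGaloisRestrict_or_exists_sq_eq_two`. [cite: Washington1997, §13.1] -/
theorem surjective_comp_absGaloisRestrict_or_exists_sq_eq_two' (hκ : κ.IsCyclotomic) :
    Function.Surjective (κ.toContinuousMonoidHom.comp (absGaloisRestrict ℚ L)) ∨ ∃ x : L, x ^ 2 = 2 := by
  by_cases hex : ∃ σ : absoluteGaloisGroup L, ¬ (2 : ℤ_[2]) ∣ (κ (absGaloisRestrict ℚ L σ)).toAdd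
  · exact Or.inl (surjective_comp_absGaloisRestrict_of_exists_not_dvd' κ L hex)
  right
  simp only [not_exists, not_not] at hex
  have hlayer : ∀ σ : absoluteGaloisGroup L, absGaloisRestrict ℚ L σ ∈ κ.layerSubgroup 1 := fun σ => by
    rw [mem_layerSubgroup, pow_one]
    exact hex σ
  obtain ⟨θ, hθ⟩ := IsCyclotomic.exists_sq_eq_two_layer_one hκ
  have hθmem := (IntermediateField.mem_fixedField_iff _ (θ : AlgebraicClosure ℚ)).mp θ.2
  have hfix : ∀ τ ∈ ((absGaloisRestrict ℚ L).range : Subgroup (absoluteGaloisGroup ℚ)),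
      τ • (θ : AlgebraicClosure ℚ) = θ := by
    rintro _ ⟨σ, rfl⟩
    exact hθmem _ ⟨absGaloisRestrict ℚ L σ, hlayer σ, rfl⟩
  obtain ⟨e, x, hex'⟩ := Rat.exists_eq_of_forall_range_absGaloisRestrict_smul L hfix
  refine ⟨x, e.toRingHom.injective ?_⟩
  have h2 : ((θ : AlgebraicClosure ℚ)) ^ 2 = 2 := by
    have := congrArg (fun t : κ.layer 1 => (t : AlgebraicClosure ℚ)) hθ
    push_cast at this
    exact this
  change e (x ^ 2) = e 2
  rw [map_pow, hex', h2, map_ofNat]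

/-- **`√2 ∉ L ⟹ κ ∘ res_{ℚ,L}` is onto, for EVERY number field `L`** — the surjectivity witness for `κ.restrict L _` (the cyclotomic `ℤ₂`-extension
`L·ℚ_∞/L`), e.g. for `L = ℚ(W[2], √−1)` of degree `12`. Degree-free form of `surjective_comp_absGaloisRestrict_of_forall_sq_ne_two`.
[cite: Washington1997, §13.1] -/
theorem surjective_comp_absGaloisRestrict_of_forall_sq_ne_two' (hκ : κ.IsCyclotomic) (h2 : ∀ x : L, x ^ 2 ≠ 2) :
    Function.Surjective (κ.toContinuousMonoidHom.comp (absGaloisRestrict ℚ L)) := by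
  rcases surjective_comp_absGaloisRestrict_or_exists_sq_eq_two' κ L hκ with h | ⟨x, hx⟩
  · exact h
  · exact absurd hx (h2 x)

end Literature.NumberTheory.EllipticCurves.ZpExtension

end
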